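import Summits.BirchSwinnertonDyer.BirchSwinnertonDyer.Theorems.SignedLowerHalvesKobayashiMainConjectureSmallImageLambdaTransferCM
import Summits.BirchSwinnertonDyer.BirchSwinnertonDyer.Theorems.SignedLowerHalvesKobayashiLowerHalfLargeImageCongruencePlaces
import Summits.BirchSwinnertonDyer.BirchSwinnertonDyer.Theorems.SignedLowerHalvesKobayashiMainConjectureSmallImageCMTransferMuRecords02
import HarnessLib

/-!
# Route `SignedLowerHalves`, crux `KobayashiMainConjectureSmallImage` (item stmt-BirchSwinnertonDyer-19002):
# small-image congruence road («L4-λ») — RECORDS part 01: the pair `(286528bi1, 3)`, BOTH signs, and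
# `BSD(E,3)` for it (cell `bsd-ssimc`, seat `bsd-ssimc-k3-c4` gen 6; planner ruling D23-7; a
# `--supports stmt-BirchSwinnertonDyer-19002 --as helper` file; closes nothing about the crux)

PARTITION (cell bsd-ssimc): X7 (A7) × ONE item-4 window pair — `286528bi1 @ 3` (`ρ̄_{E,3}` = 3Nn,
`r_an = 0`, `ord₃(L(E,1)/Ω_E) = 3`: `∏c_ℓ = 12`, `#Ш_an = 9`; NO descent instrument of the tree reaches it:
the second 3-descent front of `SecondDescent/EmptyRecordsThree3Nn01.lean` has no row for it; until now
its signed main conjecture stood MODULO the Corpuz–Lei preprint binder, `…CMTransferMuRecords02.lean`)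
— closes PER PAIR (Kobayashi's signed main conjecture for both signs and the `3`-part of BSD, from
PUBLISHED facts + displayed certificates); the crux `KobayashiMainConjectureSmallImage` stays OPEN;
nothing booked; BSD is not proved by any of this. THEOREMS ONLY.

## The record (shape `SmallImageCongruenceRoad.kobayashiMainConjecture_{neg_one,one}_of_cmPartner_of_mazurTate`)

Target `E = [0,0,0,−2257739,−899276840]` (Cremona 286528bi1, `N = 286528 = 2⁶·11²·37`); partner
`A = [0,0,0,121,0] : y² = x³ + 121x` (Cremona 7744t1, `N′ = 7744 = 2⁶·11²`, CM by `ℤ[i]`, `3` inert, `r_an = 1`),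
`E[3] ≃ A[3]` by the KERNEL certificate `threeCongruent_of_hesseCertificate_unconditional` (Hesse pencil of
`A` at `(λ:μ) = (88:5)`, `u = 44/5`, as in `…CMTransferMuRecords02.lean`). CERTIFICATES (kit **j261781**,
`--tag bsd`, three engines, evidence on the item; file of record HOME/bsd-ssimc-k3-c4/g6/): `E`: odd layer
`θ_3`, `(μ, λ) = (0, 10) = (0, deg ω_3^+ + 4)` — engine B (b2b lit-g7 msengine, exact symbols) AND engine T
(iw-2 twisted `L`-values, `V = v₃(Norm S_ψ) = 10 < 18`, CERTIFIED); even layer `θ_2`, `(μ, λ) = (0, 6) =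
(0, deg ω_2^- + 4)` — engine B (and b2b iw-2's independent engine-B run `ss500k_pairs.tsv`: λ± = 4 stable to
layer 6; engine T consistent, `V = 6`); `A`: `θ_1`, `(0, 1)`, and `θ_2`, `(0, 3) = (0, 2 + 1)` — engines B, T
(CERTIFIED, exact match with PARI `msfromell`) and A (`ellpadiclambdamu = [[1,1],[0,0]]`). `Σ₀ = {2, 11, 37}`,
KERNEL-DECIDED by the place toolkit (p465598): `δ_E = (0, 0, 3)` (additive, additive, split `37 ≡ 1 (mod 3)`,
`s_37 = 3`), `δ_A = (0, 0, 6)` (additive, additive, good with `#Ã(𝔽_37) = 36 ≡ 0`, `37 ≡ 1`, `s_37 = 3`);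
bookkeeping `4 + 3 = 1 + 6` for both signs — Kim's transfer PREDICTS λ(X^±(E)) = 4 and the certificate
reads λ(L^±_3(E)) = 4. Published inputs BY NAME (`h12 h41 h5 h3 h09 hKim hPR hmod hPollack`); data binders:
the two literal models as `hW`/`hA` with their minimality/ellipticity instances, `NeZero` conductors, the
newforms `f₀, f₀′`, and the certificate quadruples. NO `Surj`, NO `BSD(E,3)` input, NO preprint.

References: [Kobayashi2003] Conj. (p. 2), Thm. 1.2, 4.1; [BDKim2009] Cor. 2.13, 2.5, Prop. 2.6;
[PollackRubin2004] Thm. (p. 448); [Pollack2003] Def. 6.15, Prop. 6.9/6.10/6.18; [Fisher2012Hessian] §13;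
[GreenbergVatsal2000] Prop. (2.4); [BDKim2013] Cor. 3.15; [Cremona2006] Table 1 (286528bi1, 7744t1).
-/

set_option autoImplicit false
set_option linter.dupNamespace false
noncomputable section

open scoped Classical MatrixGroups ModularForm BigOperators

open CongruenceSubgroup WeierstrassCurve NumberField IsDedekindDomain Rat.HeightOneSpectrum
  Literature.NumberTheory.EllipticCurves
  Literature.NumberTheory.EllipticCurves.ModularForms
  Literature.NumberTheory.EllipticCurves.Rank1Residual
  Literature.NumberTheory.EllipticCurves.Rank1Residual.Typed
  Literature.NumberTheory.EllipticCurves.Kobayashi2003 ZpExtension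
  Literature.NumberTheory.EllipticCurves.GreenbergVatsal2000
  Literature.NumberTheory.EllipticCurves.BDKim2009
  Literature.NumberTheory.EllipticCurves.Fisher2012
  Literature.NumberTheory.EllipticCurves.Rank1Residual.X11RankOneCertificates
  Literature.NumberTheory.GaloisRepresentations
  Summit.BirchSwinnertonDyer.Rank1Residual.X1.MuLambda
  Summit.BirchSwinnertonDyer.Rank1Residual.Supersingular
  Summit.BirchSwinnertonDyer.Rank1Residual.X2.LocalDeltaCalculus
  Summit.BirchSwinnertonDyer.BirchSwinnertonDyer.Rank1Residual.IntModel
  Summit.BirchSwinnertonDyer.BirchSwinnertonDyer.Rank1Residual.X11RankOne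
  Summit.BirchSwinnertonDyer.Rank1Residual.X11b
  Summit.BirchSwinnertonDyer.BirchSwinnertonDyer.Theorems.CongruenceRoad

namespace Summit.BirchSwinnertonDyer.BirchSwinnertonDyer.Theorems.SmallImageCongruenceRoad

/-! ### §1 Kernel data of the pair -/

/-- `#Ã(𝔽_37) = 36` for the partner `7744t1 = [0,0,0,121,0]` (`a_37 = 2`; fast count). [cite: Cremona2006, Table 1 (Cremona label 7744t1)] -/
theorem countPoints_7744t1_37 : countPoints [0, 0, 0, 121, 0] 37 = (36 : ℕ) :=
  countPoints_eq_of_fast (by decide +kernel)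

/-- **The δ-bookkeeping of `(286528bi1, 7744t1)` at `3`, KERNEL-DECIDED**: with `Σ₀` the places over
`{2, 11, 37}` (away from `3`, containing every bad place of both curves), `Σ_{Σ₀} δ_E = 3` and
`Σ_{Σ₀} δ_A = 6`; packaged with the two containment facts the road consumes. [cite: GreenbergVatsal2000, §2 Prop. (2.4) (p. 22)]
[cite: SilvermanAEC2009, VII.5 Prop. 5.1] [cite: Cremona2006, Table 1 (Cremona labels 286528bi1, 7744t1)] -/
theorem places_286528bi1_7744t1 (W A : WeierstrassCurve ℚ) [W.IsElliptic] [W.IsGloballyMinimal]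
    [A.IsElliptic] [A.IsGloballyMinimal]
    (hW : W = ⟨0, 0, 0, -2257739, -899276840⟩) (hA : A = ⟨0, 0, 0, 121, 0⟩) :
    ∃ S₀ : Finset (HeightOneSpectrum (𝓞 ℚ)), (∀ v ∈ S₀, ((3 : ℕ) : 𝓞 ℚ) ∉ v.asIdeal) ∧
      (∀ v : HeightOneSpectrum (𝓞 ℚ), ¬ W.HasGoodReductionAt v → v ∈ S₀) ∧
      (∀ v : HeightOneSpectrum (𝓞 ℚ), ¬ A.HasGoodReductionAt v → v ∈ S₀) ∧
      ∑ v ∈ S₀, delta W 3 v = 3 ∧ ∑ v ∈ S₀, delta A 3 v = 6 := by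
  have hI : integralModelInt W = ⟨0, 0, 0, -2257739, -899276840⟩ :=
    integralModelInt_eq_of_map_eq _ (by rw [hW]; ext <;> simp [WeierstrassCurve.map])
  have hI' : integralModelInt A = ⟨0, 0, 0, 121, 0⟩ :=
    integralModelInt_eq_of_map_eq _ (by rw [hA]; ext <;> simp [WeierstrassCurve.map])
  set v2 : HeightOneSpectrum (𝓞 ℚ) := (primesEquiv (R := 𝓞 ℚ)).symm ⟨2, Nat.prime_two⟩ with hv2
  set v11 : HeightOneSpectrum (𝓞 ℚ) := (primesEquiv (R := 𝓞 ℚ)).symm ⟨11, by norm_num⟩ with hv11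
  set v37 : HeightOneSpectrum (𝓞 ℚ) := (primesEquiv (R := 𝓞 ℚ)).symm ⟨37, by norm_num⟩ with hv37
  -- δ-terms of `E`: additive at 2 and 11, split multiplicative at 37 (`37 ≡ 1 (mod 3)`, `s_37 = 3`)
  have d2 : delta W 3 v2 = 0 :=
    delta_eq_zero_of_dvd_of_dvd hI 3 v2 (by rw [hv2, natGenerator_symm]; decide)
      (by rw [hv2, natGenerator_symm]; decide)
  have d11 : delta W 3 v11 = 0 :=
    delta_eq_zero_of_dvd_of_dvd hI 3 v11 (by rw [hv11, natGenerator_symm]; decide)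
      (by rw [hv11, natGenerator_symm]; decide)
  have d37 : delta W 3 v37 = 3 := by
    rw [delta_eq_of_split hI 3 v37 37 (by norm_num) (by rw [hv37, natGenerator_symm]) (by decide) (by decide)
      ⟨13, by decide +kernel⟩, sFactor_eq_of_eq_pow_mul (k := 1) (m := 152) (by norm_num) (by norm_num)]
    decide
  -- δ-terms of `A`: additive at 2 and 11, good at 37 with `#Ã(𝔽_37) = 36 ≡ 0 (mod 3)`
  have e2 : delta A 3 v2 = 0 :=
    delta_eq_zero_of_dvd_of_dvd hI' 3 v2 (by rw [hv2, natGenerator_symm]; decide)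
      (by rw [hv2, natGenerator_symm]; decide)
  have e11 : delta A 3 v11 = 0 :=
    delta_eq_zero_of_dvd_of_dvd hI' 3 v11 (by rw [hv11, natGenerator_symm]; decide)
      (by rw [hv11, natGenerator_symm]; decide)
  have e37 : delta A 3 v37 = 6 := by
    rw [delta_eq_of_good_of_dvd_count hI' 3 v37 37 (by norm_num) (by rw [hv37, natGenerator_symm]) (by norm_num)
      (by norm_num) rfl (by decide) countPoints_7744t1_37 (by decide),
      sFactor_eq_of_eq_pow_mul (k := 1) (m := 152) (by norm_num) (by norm_num)]
    decide
  have n1 : v2 ∉ ({v11, v37} : Finset (HeightOneSpectrum (𝓞 ℚ))) := by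
    simp only [Finset.mem_insert, Finset.mem_singleton, hv2, hv11, hv37, not_or]
    exact ⟨symm_ne_symm _ _ (by norm_num), symm_ne_symm _ _ (by norm_num)⟩
  have n2 : v11 ∉ ({v37} : Finset (HeightOneSpectrum (𝓞 ℚ))) := by
    simp only [Finset.mem_singleton, hv11, hv37]
    exact symm_ne_symm _ _ (by norm_num)
  refine ⟨{v2, v11, v37}, ?_, ?_, ?_, ?_, ?_⟩
  · intro v hv
    simp only [Finset.mem_insert, Finset.mem_singleton] at hv
    rcases hv with rfl | rfl | rfl
    · exact natCast_not_mem_symm (by norm_num) _ (by norm_num)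
    · exact natCast_not_mem_symm (by norm_num) _ (by norm_num)
    · exact natCast_not_mem_symm (by norm_num) _ (by norm_num)
  · -- `Σ₀ ⊇` bad places of `E`: `Δ(E) = 2⁶·11⁹·37⁶`
    intro v hv
    by_contra hvS
    apply hv
    apply hasGoodReductionAt_of_not_dvd hI
    intro hdvd
    have hΔ : (⟨0, 0, 0, -2257739, -899276840⟩ : WeierstrassCurve ℤ).Δ = 2 ^ 6 * 11 ^ 9 * 37 ^ 6 := by
      decide
    rw [hΔ] at hdvd
    have hpr := prime_natGenerator v
    have h' : natGenerator v ∣ 2 ^ 6 * 11 ^ 9 * 37 ^ 6 := by exact_mod_cast hdvd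
    have key : natGenerator v = 2 ∨ natGenerator v = 11 ∨ natGenerator v = 37 := by
      rcases (Nat.Prime.dvd_mul hpr).mp h' with h | h
      · rcases (Nat.Prime.dvd_mul hpr).mp h with h | h
        · exact Or.inl ((Nat.prime_dvd_prime_iff_eq hpr Nat.prime_two).mp (hpr.dvd_of_dvd_pow h))
        · exact Or.inr (Or.inl ((Nat.prime_dvd_prime_iff_eq hpr (by norm_num)).mp (hpr.dvd_of_dvd_pow h)))
      · exact Or.inr (Or.inr ((Nat.prime_dvd_prime_iff_eq hpr (by norm_num)).mp (hpr.dvd_of_dvd_pow h)))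
    apply hvS
    simp only [Finset.mem_insert, Finset.mem_singleton]
    rcases key with h | h | h
    · exact Or.inl (eq_symm_of_natGenerator_eq Nat.prime_two h)
    · exact Or.inr (Or.inl (eq_symm_of_natGenerator_eq (by norm_num) h))
    · exact Or.inr (Or.inr (eq_symm_of_natGenerator_eq (by norm_num) h))
  · -- `Σ₀ ⊇` bad places of `A`: `Δ(A) = −2⁶·11⁶`
    intro v hv
    by_contra hvS
    apply hv
    apply hasGoodReductionAt_of_not_dvd hI'
    intro hdvd
    have hΔ : (⟨0, 0, 0, 121, 0⟩ : WeierstrassCurve ℤ).Δ = -(2 ^ 6 * 11 ^ 6) := by decide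
    rw [hΔ, dvd_neg] at hdvd
    have hpr := prime_natGenerator v
    have h' : natGenerator v ∣ 2 ^ 6 * 11 ^ 6 := by exact_mod_cast hdvd
    have key : natGenerator v = 2 ∨ natGenerator v = 11 := by
      rcases (Nat.Prime.dvd_mul hpr).mp h' with h | h
      · exact Or.inl ((Nat.prime_dvd_prime_iff_eq hpr Nat.prime_two).mp (hpr.dvd_of_dvd_pow h))
      · exact Or.inr ((Nat.prime_dvd_prime_iff_eq hpr (by norm_num)).mp (hpr.dvd_of_dvd_pow h))
    apply hvS
    simp only [Finset.mem_insert, Finset.mem_singleton]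
    rcases key with h | h
    · exact Or.inl (eq_symm_of_natGenerator_eq Nat.prime_two h)
    · exact Or.inr (Or.inl (eq_symm_of_natGenerator_eq (by norm_num) h))
  · norm_num [Finset.sum_insert n1, Finset.sum_insert n2, Finset.sum_singleton, d2, d11, d37]
  · norm_num [Finset.sum_insert n1, Finset.sum_insert n2, Finset.sum_singleton, e2, e11, e37]

/-! ### §2 The records: both signs -/

/-- **`lam4_286528bi1_3` — Kobayashi's main conjecture for `(286528bi1, 3, ε)`, EITHER sign, AT THE PAIR by
the small-image congruence road (NO preprint, NO `Surj`, NO `BSD(E,3)` input).** Certificates DISPLAYED as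
hypotheses: for `E` the odd row `θ_3` (`λ = 6 + 4`) if `ε = −1`, the even row `θ_2` (`λ = 2 + 4`) if
`ε = 1`; for the CM partner `A = 7744t1` the rows `θ_1` (`λ = 0 + 1`) / `θ_2` (`λ = 2 + 1`) (kit j261781:
engines B + T, exact match with `msfromell` on `A`; engine A `[[1,1],[0,0]]`). The `3`-congruence and the
δ-bookkeeping `4 + 3 = 1 + 6` are KERNEL-CHECKED; `a_3(E) = a_3(A) = 0`, `3 ∤ Δ`, CM of `A` decided in the
kernel. Published inputs BY NAME. PER PAIR; nothing booked; BSD is not proved by any of this.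
[cite: Kobayashi2003, Conjecture (p. 2), Thm. 1.2 and Thm. 4.1] [cite: BDKim2009, Cor. 2.13, Cor. 2.5 and Prop. 2.6 (pp. 185–187)]
[cite: PollackRubin2004, Theorem (p. 448) = Thm. 7.3] [cite: Pollack2003, Def. 6.15, Prop. 6.9, 6.10 and 6.18]
[cite: Fisher2012Hessian, §13 (Hesse pencil, n = 3)] [cite: GreenbergVatsal2000, §2 Prop. (2.4)]
[cite: Cremona2006, Table 1 (Cremona labels 286528bi1, 7744t1)] -/
theorem lam4_kobayashiMainConjecture_286528bi1_3
    (h12 : Kobayashi2003.thm12_signedSelmerDual_finite_torsion)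
    (h41 : Kobayashi2003.thm41_signedCharIdeal_divisibility)
    (h5 : realPeriodRat_eq_unit_mul_plusPeriod) (h3 : realPeriodRat_eq_unit_mul_plusPeriod_three)
    (h09 : cor213_signedMu_eq_zero_iff_of_torsionIso)
    (hKim : BDKim2009.cor213_signedLambda_add_sum_delta_eq_of_torsionIso)
    (hPR : PollackRubin2004.mainTheorem_signedCharIdeal_eq_of_cm)
    (hmod : nonempty_modularParametrizationData)
    (W A : WeierstrassCurve ℚ) [W.IsElliptic] [W.IsGloballyMinimal] [A.IsElliptic] [A.IsGloballyMinimal]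
    [Fact (Nat.Prime 3)] (hW : W = ⟨0, 0, 0, -2257739, -899276840⟩) (hA : A = ⟨0, 0, 0, 121, 0⟩)
    (hPollack : ∀ {N : ℕ} [NeZero N] {f : CuspForm (Gamma0 N) 2},
      pollack_exists_plusMinusPAdicLFunction (W := A) (f := f) (p := 3))
    [NeZero (W.conductorNorm ℤ)] {f₀ : CuspForm (Gamma0 (W.conductorNorm ℤ)) 2} (hf₀ : IsNewformOf W f₀)
    [NeZero (A.conductorNorm ℤ)] {f₀' : CuspForm (Gamma0 (A.conductorNorm ℤ)) 2} (hf₀' : IsNewformOf A f₀')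
    (ε : ℤˣ) {Θ Θ' : IwasawaAlgebra 3} (hΘ0 : Θ ≠ 0) (hμ : mu Θ = 0) (hΘ'0 : Θ' ≠ 0) (hμ' : mu Θ' = 0)
    (hrow : (ε = -1 ∧
        iwasawaToPowerSeries 3 Θ = ((mazurTateElement f₀ 3 3).map (algebraMap ℚ ℚ_[3]) : PowerSeries ℚ_[3]) ∧
        lam Θ = (cyclotomicOmegaPlus 3 3).natDegree + 4 ∧
        iwasawaToPowerSeries 3 Θ' = ((mazurTateElement f₀' 3 1).map (algebraMap ℚ ℚ_[3]) : PowerSeries ℚ_[3]) ∧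
        lam Θ' = (cyclotomicOmegaPlus 3 1).natDegree + 1) ∨
      (ε = 1 ∧
        iwasawaToPowerSeries 3 Θ = ((mazurTateElement f₀ 3 2).map (algebraMap ℚ ℚ_[3]) : PowerSeries ℚ_[3]) ∧
        lam Θ = (cyclotomicOmegaMinus 3 2).natDegree + 4 ∧
        iwasawaToPowerSeries 3 Θ' = ((mazurTateElement f₀' 3 2).map (algebraMap ℚ ℚ_[3]) : PowerSeries ℚ_[3]) ∧
        lam Θ' = (cyclotomicOmegaMinus 3 2).natDegree + 1)) :
    KobayashiMainConjecture W 3 ε := by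
  have hI : integralModelInt W = ⟨0, 0, 0, -2257739, -899276840⟩ :=
    integralModelInt_eq_of_map_eq _ (by rw [hW]; ext <;> simp [WeierstrassCurve.map])
  have hI' : integralModelInt A = ⟨0, 0, 0, 121, 0⟩ :=
    integralModelInt_eq_of_map_eq _ (by rw [hA]; ext <;> simp [WeierstrassCurve.map])
  have hp2 : (3 : ℕ) ≠ 2 := by decide
  -- good supersingular at 3 with `a_3 = 0`, both curves
  have hSS : GoodSS W 3 := goodSS_of_intModel 3 hI (by decide) card_c286528bi1_3 (by norm_num)
  have hap : W.frobeniusTrace 3 = 0 := by rw [frobeniusTrace_eq hI card_c286528bi1_3]; norm_num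
  have hSS' : GoodSS A 3 := goodSS_of_intModel 3 hI' (by decide) card_cmp121_0_3 (by norm_num)
  have hap' : A.frobeniusTrace 3 = 0 := by rw [frobeniusTrace_eq hI' card_cmp121_0_3]; norm_num
  have hcm' : A.HasCM := hasCM_cmp121_0 hI'
  -- the 3-congruence `E[3] ≃ A[3]`: Hesse pencil of `A` through `E` (Fisher), kernel-checked
  have hc4 : W.c₄ = (108371472 : ℚ) := by
    subst hW; norm_num [WeierstrassCurve.c₄, WeierstrassCurve.b₂, WeierstrassCurve.b₄]
  have hc6 : W.c₆ = (776975189760 : ℚ) := by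
    subst hW; norm_num [WeierstrassCurve.c₆, WeierstrassCurve.b₂, WeierstrassCurve.b₄, WeierstrassCurve.b₆]
  have hc4A : A.c₄ = (-5808 : ℚ) := by
    subst hA; norm_num [WeierstrassCurve.c₄, WeierstrassCurve.b₂, WeierstrassCurve.b₄]
  have hc6A : A.c₆ = (0 : ℚ) := by
    subst hA; norm_num [WeierstrassCurve.c₆, WeierstrassCurve.b₂, WeierstrassCurve.b₄, WeierstrassCurve.b₆]
  have he := threeCongruent_of_hesseCertificate_unconditional A W ((88 : ℚ) / 5) 1 ((44 : ℚ) / 5)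
    (by norm_num) (by rw [hc4A, hc6A, hc4, eval_hesseC4three]; norm_num)
    (by rw [hc4A, hc6A, hc6, eval_hesseC6three]; norm_num)
  -- the places and the bookkeeping
  obtain ⟨S₀, hS₀, hS₀W, hS₀A, hsumW, hsumA⟩ := places_286528bi1_7744t1 W A hW hA
  rcases hrow with ⟨rfl, hΘ, hlam, hΘ', hlam'⟩ | ⟨rfl, hΘ, hlam, hΘ', hlam'⟩
  · exact kobayashiMainConjecture_neg_one_of_cmPartner_of_mazurTate h12 h41 h5 h3 h09 hKim hPR hmod hp2 hSS.1
      hap hf₀ (by decide) hΘ hΘ0 hμ hlam hPollack hcm' hSS' hap' he hf₀' (by decide) hΘ' hΘ'0 hμ' hlam' S₀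
      hS₀ hS₀W hS₀A (by rw [hsumW, hsumA])
  · exact kobayashiMainConjecture_one_of_cmPartner_of_mazurTate h12 h41 h5 h3 h09 hKim hPR hmod hp2 hSS.1
      hap hf₀ (by decide) hΘ hΘ0 hμ hlam hPollack hcm' hSS' hap' he hf₀' (by decide) hΘ' hΘ'0 hμ' hlam' S₀
      hS₀ hS₀W hS₀A (by rw [hsumW, hsumA])

/-- **Item 4's statement AT THE PAIR `286528bi1 @ 3`**: `∃ ε, KobayashiMainConjecture W 3 ε` (indeed both
signs), from `lam4_kobayashiMainConjecture_286528bi1_3` with the odd rows. PER PAIR; the crux is untouched;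
nothing booked. [cite: Kobayashi2003, Conjecture (p. 2) and Thm. 4.1] [cite: BDKim2009, Cor. 2.13 (p. 187)]
[cite: Cremona2006, Table 1 (Cremona labels 286528bi1, 7744t1)] -/
theorem lam4_exists_kobayashiMainConjecture_286528bi1_3
    (h12 : Kobayashi2003.thm12_signedSelmerDual_finite_torsion)
    (h41 : Kobayashi2003.thm41_signedCharIdeal_divisibility)
    (h5 : realPeriodRat_eq_unit_mul_plusPeriod) (h3 : realPeriodRat_eq_unit_mul_plusPeriod_three)
    (h09 : cor213_signedMu_eq_zero_iff_of_torsionIso)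
    (hKim : BDKim2009.cor213_signedLambda_add_sum_delta_eq_of_torsionIso)
    (hPR : PollackRubin2004.mainTheorem_signedCharIdeal_eq_of_cm)
    (hmod : nonempty_modularParametrizationData)
    (W A : WeierstrassCurve ℚ) [W.IsElliptic] [W.IsGloballyMinimal] [A.IsElliptic] [A.IsGloballyMinimal]
    [Fact (Nat.Prime 3)] (hW : W = ⟨0, 0, 0, -2257739, -899276840⟩) (hA : A = ⟨0, 0, 0, 121, 0⟩)
    (hPollack : ∀ {N : ℕ} [NeZero N] {f : CuspForm (Gamma0 N) 2},
      pollack_exists_plusMinusPAdicLFunction (W := A) (f := f) (p := 3))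
    [NeZero (W.conductorNorm ℤ)] {f₀ : CuspForm (Gamma0 (W.conductorNorm ℤ)) 2} (hf₀ : IsNewformOf W f₀)
    [NeZero (A.conductorNorm ℤ)] {f₀' : CuspForm (Gamma0 (A.conductorNorm ℤ)) 2} (hf₀' : IsNewformOf A f₀')
    {Θ Θ' : IwasawaAlgebra 3}
    (hΘ : iwasawaToPowerSeries 3 Θ = ((mazurTateElement f₀ 3 3).map (algebraMap ℚ ℚ_[3]) : PowerSeries ℚ_[3]))
    (hΘ0 : Θ ≠ 0) (hμ : mu Θ = 0) (hlam : lam Θ = (cyclotomicOmegaPlus 3 3).natDegree + 4)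
    (hΘ' : iwasawaToPowerSeries 3 Θ' = ((mazurTateElement f₀' 3 1).map (algebraMap ℚ ℚ_[3]) : PowerSeries ℚ_[3]))
    (hΘ'0 : Θ' ≠ 0) (hμ' : mu Θ' = 0) (hlam' : lam Θ' = (cyclotomicOmegaPlus 3 1).natDegree + 1) :
    ∃ ε : ℤˣ, KobayashiMainConjecture W 3 ε :=
  ⟨-1, lam4_kobayashiMainConjecture_286528bi1_3 h12 h41 h5 h3 h09 hKim hPR hmod W A hW hA hPollack hf₀ hf₀'
    (-1) hΘ0 hμ hΘ'0 hμ' (Or.inl ⟨rfl, hΘ, hlam, hΘ', hlam'⟩)⟩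

/-- **`BSD(E,3)` for `286528bi1` (X7, `r_an = 0`, `3Nn`, `ord₃ #Ш_an = 2`) through the IMAGE-FREE rank-0 road**
`bsdp_of_kobayashiMainConjecture_of_analyticRank_eq_zero` (Kobayashi Thm. 1.2 `h12`, B. D. Kim 2013 Cor. 3.15
`hKim13`, Pollack `hPollackW`, modularity `hmod`/`hmod'`, GZK `hGZK`) fed with the main conjecture of
`lam4_kobayashiMainConjecture_286528bi1_3` (odd rows, `ε = −1`); the rank datum `hr : r_an = 0` (Cremona) is
displayed; class X7 decided in the kernel (good supersingular at `3`, `#Ẽ(𝔽_3) = 4`, additive at `2`). A pair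
with NO descent certificate in the tree (`dim Sel₃ = 2`, second-descent front failed) and until now only a
preprint-conditional record. PER PAIR; nothing booked; BSD is not proved by any of this.
[cite: Kobayashi2003, Thm. 1.2 and Conjecture (p. 2)] [cite: BDKim2013, Cor. 3.15 (p. 199)]
[cite: BDKim2009, Cor. 2.13 (p. 187)] [cite: Miller2011LMS, Def. 1.1] [cite: Cremona2006, Table 1 (Cremona labels 286528bi1, 7744t1)] -/
theorem lam4_bsdp_286528bi1_3
    (h12 : Kobayashi2003.thm12_signedSelmerDual_finite_torsion)
    (h41 : Kobayashi2003.thm41_signedCharIdeal_divisibility)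
    (h5 : realPeriodRat_eq_unit_mul_plusPeriod) (h3 : realPeriodRat_eq_unit_mul_plusPeriod_three)
    (h09 : cor213_signedMu_eq_zero_iff_of_torsionIso)
    (hKim : BDKim2009.cor213_signedLambda_add_sum_delta_eq_of_torsionIso)
    (hPR : PollackRubin2004.mainTheorem_signedCharIdeal_eq_of_cm)
    (hmod : nonempty_modularParametrizationData) (hmod' : hasEntireLFunction_rat)
    (hKim13 : BDKim2013.cor315_signedCharValue_rankZero)
    (hGZK : rank_eq_analyticRank_of_analyticRank_le_one)
    (W A : WeierstrassCurve ℚ) [W.IsElliptic] [W.IsGloballyMinimal] [A.IsElliptic] [A.IsGloballyMinimal]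
    [Fact (Nat.Prime 3)] (hW : W = ⟨0, 0, 0, -2257739, -899276840⟩) (hA : A = ⟨0, 0, 0, 121, 0⟩)
    (hr : W.analyticRank = 0)
    (hPollack : ∀ {N : ℕ} [NeZero N] {f : CuspForm (Gamma0 N) 2},
      pollack_exists_plusMinusPAdicLFunction (W := A) (f := f) (p := 3))
    (hPollackW : ∀ {N : ℕ} [NeZero N] {f : CuspForm (Gamma0 N) 2},
      pollack_exists_plusMinusPAdicLFunction (W := W) (f := f) (p := 3))
    [NeZero (W.conductorNorm ℤ)] {f₀ : CuspForm (Gamma0 (W.conductorNorm ℤ)) 2} (hf₀ : IsNewformOf W f₀)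
    [NeZero (A.conductorNorm ℤ)] {f₀' : CuspForm (Gamma0 (A.conductorNorm ℤ)) 2} (hf₀' : IsNewformOf A f₀')
    {Θ Θ' : IwasawaAlgebra 3}
    (hΘ : iwasawaToPowerSeries 3 Θ = ((mazurTateElement f₀ 3 3).map (algebraMap ℚ ℚ_[3]) : PowerSeries ℚ_[3]))
    (hΘ0 : Θ ≠ 0) (hμ : mu Θ = 0) (hlam : lam Θ = (cyclotomicOmegaPlus 3 3).natDegree + 4)
    (hΘ' : iwasawaToPowerSeries 3 Θ' = ((mazurTateElement f₀' 3 1).map (algebraMap ℚ ℚ_[3]) : PowerSeries ℚ_[3]))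
    (hΘ'0 : Θ' ≠ 0) (hμ' : mu Θ' = 0) (hlam' : lam Θ' = (cyclotomicOmegaPlus 3 1).natDegree + 1) :
    BSDp W 3 := by
  have hI : integralModelInt W = ⟨0, 0, 0, -2257739, -899276840⟩ :=
    integralModelInt_eq_of_map_eq _ (by rw [hW]; ext <;> simp [WeierstrassCurve.map])
  have hp2 : (3 : ℕ) ≠ 2 := by decide
  have hX : ClassX7 W 3 :=
    classX7_of_intModel 3 hI (by decide) card_c286528bi1_3 (by norm_num) 2 Nat.prime_two (by decide) (by decide)
  have hap : W.frobeniusTrace 3 = 0 := by rw [frobeniusTrace_eq hI card_c286528bi1_3]; norm_num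
  exact bsdp_of_kobayashiMainConjecture_of_analyticRank_eq_zero W 3 h12 hKim13 hPollackW hmod hmod' hGZK hp2
    hX.1.1 hap (ClassX7.irr W 3 hp2 hX) hr
    (lam4_kobayashiMainConjecture_286528bi1_3 h12 h41 h5 h3 h09 hKim hPR hmod W A hW hA hPollack hf₀ hf₀' (-1)
      hΘ0 hμ hΘ'0 hμ' (Or.inl ⟨rfl, hΘ, hlam, hΘ', hlam'⟩))

end Summit.BirchSwinnertonDyer.BirchSwinnertonDyer.Theorems.SmallImageCongruenceRoad

end
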